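import Mathlib
import HarnessLib
import Summits.KontsevichZagierPeriods.Zeta5Search.TwoTaleL25LineRep
import Summits.KontsevichZagierPeriods.Zeta5Search.Denom.TwoTaleP15StripShift

/-!
# RUNG L(2/5) `(32,27,22,37 | 0,5,10,64)` — the strip shift PROVED, and `DecayL25 c` from one half-line bound

HONEST FRAMING: systematic search; no irrationality claim unless certified.  Cell pub-zeta5 (measure-opt g0), the L(2/5)
twin of P1's `TwoTaleD1StripShift` (file T2 of the D1 programme).  Pure complex analysis, no measure or irrationality
claim: this file discharges the strip-shift hypothesis `hShift` of `TwoTaleL25LineRep.decayL25_of_lineBound` — the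
vertical line of the Barnes-type integral `lineIntegralL25 n x = (1/2π) ∫ (π/sin π(x+iy))² Rₙ(x − a₂* + iy) dy`
([Zudilin2014ZetaTwo, Prop. 1 (P4)] at the cone point `a = (32n+1, 27n+1, 22n+1, 37n+1)`, `b = (1, 5n+1, 10n+1, 64n+2)`,
`a₂* = 27n+1`) may be moved from `x = ½` to any half-integer abscissa `x = m + ½`, `m ≤ 22n`.
Method: iterate fam-denom's abstract unit step `KernelStripStep.integral_kernel_step` over `m = 1, …, 22n`.
At each such `m` the shifted rational function `g(t) = Rₙ(t − a₂*)` has a DOUBLE zero (the factor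
`t − a₂* + i`, `i = a₂* − m ∈ [5n+1, 27n]`, occurs in the numerator blocks `i ∈ [1, 32n]` and `i ∈ [5n+1, 27n]`),
is holomorphic on `Re t ≥ ½` (the polar factors `t − a₂* + i`, `i ≥ 37n+1`, have real part `≥ 10n + ½`), and is
bounded by `A·(1 + (Im t)²)^{33n}` on each strip (a product of `66n = 2·33n` linear factors over a polar block of
norm `≥ 1`).  The general Literature function `Zudilin2014.RC` is first rewritten as a product of
`ℕ`-indexed blocks (`gL25_eq`).
Main results: `stripShiftL25_holds : ∀ n ≥ 1, ∀ m ≤ 22n, lineIntegralL25 n (m + ½) = lineIntegralL25 n ½`;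
the corollary `decayL25_of_halfLineBound` = `decayL25_of_lineBound` with the strip shift discharged (the one
remaining input, an eventual bound on one half-line, is `TwoTaleL25LineRate` + the one-variable certificate
`TwoTaleL25LineCertificate`, assembled in `TwoTaleL25Decay`).
References: W. Zudilin, arXiv:1310.1526 [Zudilin2014ZetaTwo] Prop. 1, Lemma 6.
-/

noncomputable section

open Complex Set MeasureTheory Filter Topology Finset Polynomial
open Literature.NumberTheory.Transcendental
open Literature.NumberTheory.Irrationality.Zudilin2014
open Summit.KontsevichZagierPeriods.Zeta5Search
open Summit.KontsevichZagierPeriods.Zeta5Search.Denom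
open Summit.KontsevichZagierPeriods.Zeta5Search.Denom.TwoTaleL25Forms
open Summit.KontsevichZagierPeriods.Zeta5Search.Denom.TwoTaleP15Decay (kernelSq)
open Summit.KontsevichZagierPeriods.Zeta5Search.Denom.KernelStripStep
open Summit.KontsevichZagierPeriods.Zeta5Search.Denom.TwoTaleP15StripShift
  (half_le_re_of_mem_halfStrip one_add_abs_sq_le_two_mul)
open Summit.KontsevichZagierPeriods.Zeta5Search.TwoTaleL25LineRep

namespace Summit.KontsevichZagierPeriods.Zeta5Search.TwoTaleL25StripShift

/-! ### The blocks of `Rₙ(t − a₂*)` -/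

/-- An `ℕ`-indexed block `∏_{i ∈ [lo, hi)} (t − a₂* + i)` of `Rₙ(t − a₂*)`, `a₂* = 27n + 1`. -/
def dBlock (n lo hi : ℕ) (t : ℂ) : ℂ := ∏ i ∈ Ico lo hi, (t - (27 * n + 1) + i)

/-- The shifted rational function `g(t) = Rₙ(t − a₂*)` at L(2/5). -/
def gL25 (n : ℕ) (t : ℂ) : ℂ := ratRCL25 n (t - (27 * n + 1))

/-- A Literature `ℤ`-indexed block with natural end-points, evaluated at `t − a₂*`, is the `ℕ`-block. -/
theorem aeval_block_eq_dBlock (n lo hi : ℕ) (t : ℂ) :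
    aeval (t - (27 * n + 1)) (block (lo : ℤ) (hi : ℤ)) = dBlock n lo hi t := by
  rw [aeval_block_complex, TwoTaleP15Bridge.Ico_natCast_eq_map, Finset.prod_map]
  simp only [Nat.castEmbedding_apply, Int.cast_natCast]
  rfl

/-- **`g` as a product of blocks**: `Rₙ(t − a₂*) = Π · B[1,32n]·B[5n+1,27n]·B[10n+1,22n] / B[37n+1,64n+1]`
(`Π = Zudilin2014.Pi (aL25 n) (bL25 n)`, a non-zero rational constant). -/
theorem gL25_eq (n : ℕ) (t : ℂ) : gL25 n t =
    ((Pi (aL25 n) (bL25 n) : ℚ) : ℂ) *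
      (dBlock n 1 (32 * n + 1) t * dBlock n (5 * n + 1) (27 * n + 1) t * dBlock n (10 * n + 1) (22 * n + 1) t) /
      dBlock n (37 * n + 1) (64 * n + 2) t := by
  have e0 : bL25 n 0 = ((1 : ℕ) : ℤ) := by simp
  have e0' : aL25 n 0 = ((32 * n + 1 : ℕ) : ℤ) := by rw [aL25_zero]; push_cast; ring
  have e1 : bL25 n 1 = ((5 * n + 1 : ℕ) : ℤ) := by rw [bL25_one]; push_cast; ring
  have e1' : aL25 n 1 = ((27 * n + 1 : ℕ) : ℤ) := by rw [aL25_one]; push_cast; ring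
  have e2 : bL25 n 2 = ((10 * n + 1 : ℕ) : ℤ) := by rw [bL25_two]; push_cast; ring
  have e2' : aL25 n 2 = ((22 * n + 1 : ℕ) : ℤ) := by rw [aL25_two]; push_cast; ring
  have e3 : aL25 n 3 = ((37 * n + 1 : ℕ) : ℤ) := by rw [aL25_three]; push_cast; ring
  have e3' : bL25 n 3 = ((64 * n + 2 : ℕ) : ℤ) := by rw [bL25_three]; push_cast; ring
  unfold gL25 ratRCL25 RC num den
  rw [map_mul, map_mul, e0, e0', e1, e1', e2, e2', e3, e3', aeval_block_eq_dBlock, aeval_block_eq_dBlock,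
    aeval_block_eq_dBlock, aeval_block_eq_dBlock]

/-- Each block is entire. -/
@[fun_prop]
theorem differentiable_dBlock (n lo hi : ℕ) : Differentiable ℂ (dBlock n lo hi) := by
  unfold dBlock
  fun_prop

/-- Real part of a factor: `Re (t − a₂* + i) = Re t − 27n − 1 + i`. -/
theorem re_dFactor (n i : ℕ) (t : ℂ) : (t - (27 * n + 1) + i).re = t.re - (27 * n + 1) + i := by
  have : (t - (27 * n + 1) + i : ℂ) = t + (((i : ℝ) - (27 * n + 1) : ℝ) : ℂ) := by
    push_cast
    ring
  rw [this, add_re, ofReal_re]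
  ring

/-- A polar factor has real part `≥ 10n + ½` on `Re t ≥ ½`. -/
theorem re_dFactor_ge {n i : ℕ} (hi : 37 * n + 1 ≤ i) {t : ℂ} (ht : 1 / 2 ≤ t.re) :
    10 * n + 1 / 2 ≤ (t - (27 * n + 1) + i).re := by
  have h : ((37 * n + 1 : ℕ) : ℝ) ≤ (i : ℝ) := by exact_mod_cast hi
  push_cast at h
  rw [re_dFactor]
  linarith

/-- The polar block does not vanish on `Re t ≥ ½`. -/
theorem dPolar_ne_zero {n : ℕ} {t : ℂ} (ht : 1 / 2 ≤ t.re) : dBlock n (37 * n + 1) (64 * n + 2) t ≠ 0 := by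
  rw [dBlock]
  refine Finset.prod_ne_zero_iff.2 fun i hi h => ?_
  have h1 := re_dFactor_ge (n := n) (Finset.mem_Ico.1 hi).1 ht
  rw [h, zero_re] at h1
  have : (0 : ℝ) ≤ 10 * n := by positivity
  linarith

/-- The polar block has norm `≥ 1` on `Re t ≥ ½` (`n ≥ 1`). -/
theorem one_le_norm_dPolar {n : ℕ} (hn : 1 ≤ n) {t : ℂ} (ht : 1 / 2 ≤ t.re) :
    1 ≤ ‖dBlock n (37 * n + 1) (64 * n + 2) t‖ := by
  rw [dBlock, norm_prod]
  refine Finset.one_le_prod fun i hi => ?_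
  have h1 := re_dFactor_ge (n := n) (Finset.mem_Ico.1 hi).1 ht
  have hn' : (1 : ℝ) ≤ n := by exact_mod_cast hn
  exact le_trans (by linarith) (re_le_norm _)

/-- A block containing the index `a₂* − m` vanishes at `t = m`. -/
theorem dBlock_natCast_eq_zero {n lo hi m : ℕ} (hlo : lo + m ≤ 27 * n + 1) (hhi : 27 * n + 1 < hi + m) :
    dBlock n lo hi (m : ℂ) = 0 := by
  rw [dBlock]
  have hm : m ≤ 27 * n + 1 := by omega
  refine Finset.prod_eq_zero (i := 27 * n + 1 - m) (Finset.mem_Ico.2 ⟨by omega, by omega⟩) ?_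
  rw [Nat.cast_sub hm]
  push_cast
  ring

/-! ### The hypotheses of the unit step at `m = 1, …, 22n` -/

/-- `g` as a function (for `fun_prop` and the product rule). -/
theorem gL25_eq_fun (n : ℕ) : gL25 n = fun t => ((Pi (aL25 n) (bL25 n) : ℚ) : ℂ) *
    (dBlock n 1 (32 * n + 1) t * dBlock n (5 * n + 1) (27 * n + 1) t * dBlock n (10 * n + 1) (22 * n + 1) t) /
    dBlock n (37 * n + 1) (64 * n + 2) t :=
  funext (gL25_eq n)

/-- `g(m) = 0` for `1 ≤ m ≤ 22n`. -/
theorem gL25_natCast {n m : ℕ} (h1 : 1 ≤ m) (h4 : m ≤ 22 * n) : gL25 n (m : ℂ) = 0 := by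
  rw [gL25_eq, dBlock_natCast_eq_zero (lo := 1) (hi := 32 * n + 1) (by omega) (by omega)]
  simp

/-- `g` is holomorphic on the closed strip `|Re t − m| ≤ ½`, `m ≥ 1`. -/
theorem differentiableOn_gL25 (n : ℕ) {m : ℕ} (h1 : 1 ≤ m) : DifferentiableOn ℂ (gL25 n) (halfStrip (m : ℤ)) := by
  have hden : ∀ t ∈ halfStrip (m : ℤ), dBlock n (37 * n + 1) (64 * n + 2) t ≠ 0 :=
    fun t ht => dPolar_ne_zero (half_le_re_of_mem_halfStrip h1 ht)
  rw [gL25_eq_fun]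
  fun_prop (disch := first | assumption | exact hden)

/-- `g'(m) = 0` for `1 ≤ m ≤ 22n` (two vanishing blocks ⇒ every term of the product rule vanishes). -/
theorem deriv_gL25_natCast {n m : ℕ} (h1 : 1 ≤ m) (h4 : m ≤ 22 * n) : deriv (gL25 n) (m : ℂ) = 0 := by
  have hB1 : dBlock n 1 (32 * n + 1) (m : ℂ) = 0 := dBlock_natCast_eq_zero (by omega) (by omega)
  have hB2 : dBlock n (5 * n + 1) (27 * n + 1) (m : ℂ) = 0 := dBlock_natCast_eq_zero (by omega) (by omega)
  have hre : 1 / 2 ≤ (m : ℂ).re := by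
    rw [natCast_re]
    have : (1 : ℝ) ≤ m := by exact_mod_cast h1
    linarith
  have hden : dBlock n (37 * n + 1) (64 * n + 2) (m : ℂ) ≠ 0 := dPolar_ne_zero hre
  have hA : HasDerivAt (dBlock n 1 (32 * n + 1)) _ (m : ℂ) :=
    (differentiable_dBlock n 1 (32 * n + 1)).differentiableAt.hasDerivAt
  have hB : HasDerivAt (dBlock n (5 * n + 1) (27 * n + 1)) _ (m : ℂ) :=
    (differentiable_dBlock n (5 * n + 1) (27 * n + 1)).differentiableAt.hasDerivAt
  have hC : HasDerivAt (dBlock n (10 * n + 1) (22 * n + 1)) _ (m : ℂ) :=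
    (differentiable_dBlock n (10 * n + 1) (22 * n + 1)).differentiableAt.hasDerivAt
  have hD : HasDerivAt (dBlock n (37 * n + 1) (64 * n + 2)) _ (m : ℂ) :=
    (differentiable_dBlock n (37 * n + 1) (64 * n + 2)).differentiableAt.hasDerivAt
  have h := (((hA.mul hB).mul hC).const_mul (((Pi (aL25 n) (bL25 n) : ℚ) : ℂ))).div hD hden
  rw [gL25_eq_fun]
  refine h.deriv.trans ?_
  simp [hB1, hB2]

/-! ### Polynomial growth on the strips -/

/-- A linear factor on the strip around `m ≤ 22n`: `‖t − a₂* + i‖ ≤ (113n + 3)(1 + |Im t|)` for `i < 64n + 2`. -/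
theorem norm_dFactor_le {n m i : ℕ} (hm : m ≤ 22 * n) (hi : i < 64 * n + 2) {t : ℂ}
    (ht : t ∈ halfStrip (m : ℤ)) : ‖t - (27 * n + 1) + i‖ ≤ (113 * n + 3) * (1 + |t.im|) := by
  simp only [halfStrip, Set.mem_preimage, Set.mem_Icc, Int.cast_natCast] at ht
  have hm' : (m : ℝ) ≤ 22 * n := by exact_mod_cast hm
  have hi' : (i : ℝ) ≤ 64 * n + 1 := by
    have : i ≤ 64 * n + 1 := by omega
    exact_mod_cast this
  have hn : (0 : ℝ) ≤ n := Nat.cast_nonneg n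
  have h1 : ‖t - (27 * n + 1) + i‖ ≤ ‖t‖ + ‖((27 * n + 1 : ℕ) : ℂ)‖ + ‖(i : ℂ)‖ := by
    calc ‖t - (27 * n + 1) + i‖ ≤ ‖t - (27 * n + 1)‖ + ‖(i : ℂ)‖ := norm_add_le _ _
      _ ≤ ‖t‖ + ‖((27 * n + 1 : ℕ) : ℂ)‖ + ‖(i : ℂ)‖ := by
          gcongr
          push_cast
          exact norm_sub_le _ _
  rw [Complex.norm_natCast, Complex.norm_natCast] at h1
  push_cast at h1
  have h2 : ‖t‖ ≤ |t.re| + |t.im| := norm_le_abs_re_add_abs_im t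
  have h3 : |t.re| ≤ 22 * n + 1 := by
    rw [abs_le]
    constructor <;> linarith [ht.1, ht.2]
  have h4 : 0 ≤ |t.im| := abs_nonneg _
  nlinarith [mul_nonneg (by positivity : (0 : ℝ) ≤ 113 * n + 2) h4]

/-- A block on the strip around `m ≤ 22n`: `‖dBlock n lo hi t‖ ≤ ((113n+3)(1+|Im t|))^{hi − lo}` (`hi ≤ 64n+2`). -/
theorem norm_dBlock_le {n m lo hi : ℕ} (hm : m ≤ 22 * n) (hhi : hi ≤ 64 * n + 2) {t : ℂ}
    (ht : t ∈ halfStrip (m : ℤ)) : ‖dBlock n lo hi t‖ ≤ ((113 * n + 3) * (1 + |t.im|)) ^ (hi - lo) := by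
  rw [dBlock, norm_prod, ← Nat.card_Ico lo hi, ← Finset.prod_const]
  refine Finset.prod_le_prod (fun i _ => norm_nonneg _) fun i hi' => ?_
  exact norm_dFactor_le hm (by have := (Finset.mem_Ico.1 hi').2; omega) ht

/-- **Growth**: on the strip around `m ∈ [1, 22n]`, `‖g(t)‖ ≤ A · (1 + (Im t)²)^{33n}` with
`A = |Π| (113n+3)^{66n} 2^{33n}` (the `66n = 2·33n` numerator factors). -/
theorem norm_gL25_le {n m : ℕ} (hn : 1 ≤ n) (h1 : 1 ≤ m) (hm : m ≤ 22 * n) {t : ℂ} (ht : t ∈ halfStrip (m : ℤ)) :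
    ‖gL25 n t‖ ≤ (‖((Pi (aL25 n) (bL25 n) : ℚ) : ℂ)‖ * (113 * n + 3) ^ (66 * n) * 2 ^ (33 * n)) *
      (1 + t.im ^ 2) ^ (33 * n) := by
  have hre : 1 / 2 ≤ t.re := half_le_re_of_mem_halfStrip h1 ht
  set b : ℝ := (113 * n + 3) * (1 + |t.im|) with hb
  have hb1 : 1 ≤ 1 + |t.im| := le_add_of_nonneg_right (abs_nonneg _)
  have hB1 := norm_dBlock_le (lo := 1) (hi := 32 * n + 1) hm (by omega) ht
  have hB2 := norm_dBlock_le (lo := 5 * n + 1) (hi := 27 * n + 1) hm (by omega) ht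
  have hB3 := norm_dBlock_le (lo := 10 * n + 1) (hi := 22 * n + 1) hm (by omega) ht
  have e1 : 32 * n + 1 - 1 = 32 * n := by omega
  have e2 : 27 * n + 1 - (5 * n + 1) = 22 * n := by omega
  have e3 : 22 * n + 1 - (10 * n + 1) = 12 * n := by omega
  rw [e1] at hB1
  rw [e2] at hB2
  rw [e3] at hB3
  have hD := one_le_norm_dPolar hn hre
  have h40 : 66 * n = 2 * (33 * n) := by ring
  set P : ℝ := ‖((Pi (aL25 n) (bL25 n) : ℚ) : ℂ)‖ with hP
  have hP0 : 0 ≤ P := norm_nonneg _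
  calc ‖gL25 n t‖
      = P * (‖dBlock n 1 (32 * n + 1) t‖ * ‖dBlock n (5 * n + 1) (27 * n + 1) t‖ *
          ‖dBlock n (10 * n + 1) (22 * n + 1) t‖) / ‖dBlock n (37 * n + 1) (64 * n + 2) t‖ := by
        rw [gL25_eq]
        simp only [norm_mul, norm_div, hP]
    _ ≤ P * (‖dBlock n 1 (32 * n + 1) t‖ * ‖dBlock n (5 * n + 1) (27 * n + 1) t‖ *
          ‖dBlock n (10 * n + 1) (22 * n + 1) t‖) := div_le_self (by positivity) hD
    _ ≤ P * (b ^ (32 * n) * b ^ (22 * n) * b ^ (12 * n)) := by gcongr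
    _ = P * ((113 * n + 3) ^ (66 * n) * (1 + |t.im|) ^ (66 * n)) := by
        simp only [hb, mul_pow]
        ring
    _ ≤ P * ((113 * n + 3) ^ (66 * n) * (2 ^ (33 * n) * (1 + t.im ^ 2) ^ (33 * n))) := by
        have h2 : (1 + |t.im|) ^ (66 * n) ≤ 2 ^ (33 * n) * (1 + t.im ^ 2) ^ (33 * n) := by
          calc (1 + |t.im|) ^ (66 * n) ≤ (1 + |t.im|) ^ (66 * n) := pow_le_pow_right₀ hb1 (by omega)
            _ ≤ 2 ^ (33 * n) * (1 + t.im ^ 2) ^ (33 * n) := by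
                rw [h40, pow_mul, ← mul_pow]
                exact pow_le_pow_left₀ (by positivity) (one_add_abs_sq_le_two_mul t.im) _
        exact mul_le_mul_of_nonneg_left (mul_le_mul_of_nonneg_left h2 (by positivity)) hP0
    _ = (P * (113 * n + 3) ^ (66 * n) * 2 ^ (33 * n)) * (1 + t.im ^ 2) ^ (33 * n) := by ring

/-! ### The strip shift -/

/-- The integrand of `lineIntegralL25 n x` is the kernel times `g`. -/
theorem lineIntegrandL25_eq_kernel_mul_gL25 (n : ℕ) (x y : ℝ) :
    kernelSq ((x : ℂ) + (y : ℂ) * I) * ratRCL25 n ((x : ℂ) - (27 * n + 1) + (y : ℂ) * I) =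
      ((Real.pi : ℂ) / Complex.sin (Real.pi * ((x : ℂ) + (y : ℂ) * I))) ^ 2 * gL25 n ((x : ℂ) + (y : ℂ) * I) := by
  rw [kernelSq, gL25, add_sub_right_comm]

/-- **One step**: the line `k + 1 + ½` equals the line `k + ½` (`k + 1 ≤ 22n`). -/
theorem lineIntegralL25_succ {n k : ℕ} (hn : 1 ≤ n) (hk : k + 1 ≤ 22 * n) :
    lineIntegralL25 n (((k + 1 : ℕ) : ℝ) + 1 / 2) = lineIntegralL25 n ((k : ℝ) + 1 / 2) := by
  have h1 : 1 ≤ k + 1 := by omega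
  have eL : ((((k + 1 : ℕ) : ℤ) : ℝ) - 1 / 2 : ℝ) = (k : ℝ) + 1 / 2 := by
    push_cast
    ring
  have eR : ((((k + 1 : ℕ) : ℤ) : ℝ) + 1 / 2 : ℝ) = ((k + 1 : ℕ) : ℝ) + 1 / 2 := by
    push_cast
    ring
  have e0 : ((((k + 1 : ℕ) : ℤ)) : ℂ) = ((k + 1 : ℕ) : ℂ) := by norm_cast
  have h0 : gL25 n ((((k + 1 : ℕ) : ℤ)) : ℂ) = 0 := by
    rw [e0]
    exact gL25_natCast h1 hk
  have h0' : deriv (gL25 n) ((((k + 1 : ℕ) : ℤ)) : ℂ) = 0 := by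
    rw [e0]
    exact deriv_gL25_natCast h1 hk
  have step := integral_kernel_step (differentiableOn_gL25 n h1) h0 h0' (fun t ht => norm_gL25_le hn h1 hk ht)
  rw [eL, eR] at step
  unfold lineIntegralL25
  simp_rw [lineIntegrandL25_eq_kernel_mul_gL25]
  rw [step]

/-- **The strip shift at L(2/5), PROVED**: `lineIntegralL25 n (m + ½) = lineIntegralL25 n ½` for all `m ≤ 22n`
(`n ≥ 1`) — the hypothesis `hShift` of `TwoTaleL25LineRep.decayL25_of_lineBound`. -/
theorem stripShiftL25_holds :
    ∀ n : ℕ, 1 ≤ n → ∀ m : ℕ, m ≤ 22 * n → lineIntegralL25 n ((m : ℝ) + 1 / 2) = lineIntegralL25 n (1 / 2) := by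
  intro n hn m hm
  induction m with
  | zero => simp
  | succ k ih => rw [lineIntegralL25_succ hn (by omega), ih (by omega)]

/-! ### Corollary: `DecayL25 c` from ONE eventual half-line bound -/

/-- **`DecayL25 c` from one line bound** (`decayL25_of_lineBound` with the line representation and the strip shift
both discharged): if on some half-integer line `xₙ + ½`, `xₙ ≤ 22n`, eventually
`(π/2) ∫ |Rₙ(xₙ + ½ − a₂* + iy)|/cosh²(πy) dy ≤ e^{−cn}`, then `DecayL25 c`. -/
theorem decayL25_of_halfLineBound {c : ℝ} (x : ℕ → ℕ) (hx : ∀ n, x n ≤ 22 * n)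
    (hB : ∀ᶠ n : ℕ in atTop, Real.pi / 2 *
      ∫ y : ℝ, ‖ratRCL25 n ((((x n : ℝ) + 1 / 2 : ℝ) : ℂ) - (27 * n + 1) + (y : ℂ) * I)‖ /
        Real.cosh (Real.pi * y) ^ 2 ≤ Real.exp (-(c * n))) :
    DecayL25 c :=
  decayL25_of_lineBound stripShiftL25_holds x hx hB

end Summit.KontsevichZagierPeriods.Zeta5Search.TwoTaleL25StripShift

end
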